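import Mathlib
import HarnessLib
import HarnessLib.Audit
import Summits.AtomisticToContinuum.Statement
import Literature.MathematicalPhysics.KineticTheory.HardSphereEuler
import Summits.AtomisticToContinuum.HydrodynamicLimit.Theorems.TwoClocksEntropyToHydro
import Summits.AtomisticToContinuum.HydrodynamicLimit.Theorems.ImplosionDichotomyHydroLimitInBandCoreReduction
import Summits.AtomisticToContinuum.HydrodynamicLimit.Theorems.TwoClocksClampedEntropyClockKlDivLawAtLocalGibbsNeTop
import HarnessLib.Audit.Status.Attr

/-!
Route: MirrorJeffreys

DORMANT since 2026-08-24T00:16:51Z (reconciler: no traction for 6.4 d (last activity item-evidence-added at 2026-08-17T14:51:42Z); parked, not closed — `ledger route dormant route-AtomisticToContinuum-MirrorJeffreys --off` to reactivate) — unstaffed, not closed; items shared with open routes are served there. `ledger route dormant <id> --off` reactivates.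

# Route MirrorJeffreys — Mirror Jeffreys — time reversal makes Yau's entropy two-sided and
partition-function-free: Euler in the mean, forward from the data and backward from the target, is
Euler in probability

It suffices to show X = ForwardMeanHydro ∧ BackwardMeanHydro (conforming re-open of the retired
meter route LoschmidtZermeloMeter; realises card loschmidt-is-zermelo-at-double-time, whose MOVE —
the evolved law f_t = (Φ_t)_# f₀ is a legitimate entropy REFERENCE because log f₀ is an additive
one-body statistic and the hard-sphere flow is invertible and reversible Liouville-a.e. — is here
run in the sufficient direction). ForwardMeanHydro: hydrodynamics IN THE MEAN for the data — under
the conjunct's hypotheses (local Gibbs profiles, σ < σ₀(profiles), a classical hs-Euler solution P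
on [0,T) matched at t = 0 whose local packing ρ_t(x)σ³ stays below a prover-chosen threshold η₀ —
the Statement's guard since its re-type D-0032, ∃ η₀ outermost — any flows) the EXPECTED empirical
density/momentum/energy fields at every t < T, paired with every continuous tilt (ξ_ρ, ξ_m, ξ_e),
converge to their Euler values. BackwardMeanHydro: hydrodynamics in the mean for the TARGET run
backwards — for every activity profile a whose local Gibbs law ψ_t = LG(a, u_t, θ_t) has the Euler
fields P_t, the expected tilt statistics of ψ_t transported by Φ_(−s), 0 ≤ s ≤ t, converge to their
values at P_(t−s) (by velocity reversal this is forward mean hydrodynamics of the mirrored target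
LG(a, −u_t, θ_t), whose classical Euler solution is s ↦ R̂P_(t−s), landing on R̂P₀ at s = t). Given
X, the exact finite-N MIRROR–JEFFREYS IDENTITY H(f_t|ψ_t) + H(ψ_t|f_t) = (N+1)·( E_f₀[Λ₀ − Λ_t∘Φ_t]
+ E_ψ_t[Λ_t − Λ₀∘Φ_(−t)] ), in which both partition functions cancel and no entropy functional,
pressure, equivalence of ensembles or isentropy lemma appears (Λ = tilt statistic of the entropy
variables λ(a,u,θ) = (log a − (3/2)log 2πθ − |u|²/2θ, u/θ, −1/θ)), gives H(f_t|ψ_t) ≤ J_N(t) = o(N)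
— since rev 9 this identity (as the bound H ≤ J_N, for σ ≤ 1/2, which the route's σ₀ ≤ 1/2 makes
sufficient) is PROVED INSIDE `closes` from the tree's finite-N KL ledger, no longer a separate item;
the statics of the reference ψ_t = LG(a_t, u_t, θ_t) inside the dilute band (activity inversion +
exponential law of large numbers, landed:
Theorems.EntropyClockDock.relEntropyVanishingInBand_of_gronwallCoreInBand) then yield the shared
GUARDED typed target RelEntropyVanishingInBand (stmt-AtomisticToContinuum-17396 = the Yau target
0766 with the Statement's packing guard, shared with FluxGibbsianityLdDrude / AnosovDiceHopf /
BGEndpointRigidity) INSIDE the term, and the entropy inequality (landed: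
Theorems.tendstoHydroFieldsAt_of_klDiv) yields the sub-problem Statement.
Lean: `ForwardMeanHydro ∧ BackwardMeanHydro`

## Assembly
One layer, CRUX-ONLY (rev 9, route-repair 2026-08-17; imports added in rev 8; certified in the
planner's folder: Sketch2.lean / simulated gate render rc 0, 0 sorries, axioms
propext/Classical.choice/Quot.sound, H21 audit `closes[route-AtomisticToContinuum-MirrorJeffreys]:
ok`, hypotheses = [ForwardMeanHydro, BackwardMeanHydro], non_crux = []): `theorem closes (h₂ :
ForwardMeanHydro) (h₃ : BackwardMeanHydro) : _root_.HydrodynamicLimit`. Nothing else is assumed —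
the contents of the former supports JeffreysIdentity (13651), TargetGibbsStatics (17769),
TwoSidedClosure (17770) (dropped as items) and of the assembly dock (17397, kept as the shared
`Assembly` item RelEntropyVanishingInBand → _root_.HydrodynamicLimit, provable-now, NOT a hypothesis
of `closes`) are PROVED inside the term (≈ 250 lines) from landed tree lemmas: (A) the guarded
Grönwall core KL(lawAt Φ_N f₀ t ‖ LG(a,u_t,θ_t))/(N+1) → 0 along every handed-over reference
activity a (the antecedent of
Theorems.EntropyClockDock.relEntropyVanishingInBand_of_gronwallCoreInBand), with η_c := min η_F η_B
and σ₀ := min σ_F (min σ_B (1/2)) — reference tie at time 0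
(EntropyClockDock.tie_rhoLim_of_smallDensity), the FOUR MEAN LIMITS (ForwardMeanHydro at 0 and t,
BackwardMeanHydro at s = 0 and s = t; Φ_0 = id a.e. because local Gibbs laws are Liouville-a.c.),
and the finite-N MIRROR–JEFFREYS BOUND at σ ≤ 1/2: KL ≠ ⊤
(QuenchedCellClock.stub_klDivLawAtLocalGibbsNeTop), the forward ledger
Theorems.toReal_klDiv_lawAt_localGibbsLaw_sub at t, the ECHO Theorems.klDiv_lawAt_eq at −t
(KL(ψ‖(Φ_t)_#f₀) = KL((Φ_(−t))_#ψ‖f₀)) and the same ledger backwards, the log-partition constants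
cancelling in the sum (EntropyClockDock.ae_logRatio_eq_oneBody), one-body sums = (N+1)× the inline
tilt statistics (integral_empiricalMeasure, norm_sub_sq_real), hence KL(f_t‖ψ_t).toReal ≤ J_N(t)
with J_N/(N+1) → 0, squeezed in ℝ and returned to ℝ≥0∞; (B) the statics reduction gives `hR :
RelEntropyVanishingInBand` (the shared target 17396, IN the cone of `closes`) and
Theorems.tendstoHydroFieldsAt_of_klDiv concludes `_root_.HydrodynamicLimit` by name. Route-file
imports added for this: Theorems.ImplosionDichotomyHydroLimitInBandCoreReduction,
Theorems.TwoClocksClampedEntropyClockKlDivLawAtLocalGibbsNeTop (both landed, sorry-free;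
`deps_unproved` is computed on used constants). HydroLimitForcesForward rides as the necessity
certificate of crux #2 (support, not a hypothesis). History: rev 1–3 concluded the Statement through
the unguarded 0766/9240 pair; rev 4–7 `closes := Assembly (TwoSidedClosure ⟨Forward, Backward⟩
Jeffreys Statics)` assumed four supports + the dock (glue.non-crux-hypothesis, draft); rev 9
discharges them.

Rationale: WHY THIS LINE. Mechanism: Yau's relative entropy H(f_t|ψ_t) against the Euler-driven local Gibbs
reference is the programme's currency (Yau1991; OllaVaradhanYau1993 Thm 1.1 with noise;
KipnisLandim1999 Ch. 6); on this board entropy-saturation-mean-closure /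
invariant-gibbs-entropy-bookkeeping observed that Liouville pins S(f_t), so H/(N+1) is a linear
statistic of the mean fields PLUS the thermodynamic terms (log Z_t − log Z₀)/(N+1) and the isentropy
bookkeeping (their (3a)(3b): canonical inhomogeneous entropy asymptotics, Ruelle1969 §3.4,
LebowitzPenrose1964, entropy transport). The card's move removes all of that: because log f_t = log
f₀∘Φ_(−t) is ALSO additive (in the transported configuration), the REVERSE entropy H(ψ_t|f_t) is a
linear statistic too, and in the Jeffreys sum J = H(f_t|ψ_t) + H(ψ_t|f_t) = ∫(log f_t − log ψ_t)
d(f_t − ψ_t) every normalising constant cancels EXACTLY at finite N — the N-body twin of the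
symmetrised-divergence trick, the reverse direction made tractable by Liouville transport instead of
diffusion (contrast the reverse relative entropy of BreschJabinSoler2025 for Vlasov–Fokker–Planck
mean-field limits, which needs the noise). Imported area: the dissipation-function / time-reversal
calculus of nonequilibrium statistical mechanics (EvansSearles2002; EvansSearlesWilliams2016 Ch. 3
(3.2)–(3.8): ⟨Ω_t⟩ is a KL divergence against the EVOLVED law; KawaiParrondoVandenBroeck2007;
ParrondoVandenBroeckKawai2009), with the dictionary 'reference = evolved law' ↦ H(·|f_t),
'dissipation over 2t' ↦ the card's Loschmidt–Zermelo identity H(f_t‖R_#f_t) = H(f_2t|f₀) (the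
rest-data diagonal of the same move; a remark since rev 8, formerly support LoschmidtZermelo),
'backward protocol' ↦ BackwardMeanHydro. What the line does that prior routes do not: (i) it DECIDES
the Statement — since rev 8 CRUX-ONLY, `closes : ForwardMeanHydro → BackwardMeanHydro →
_root_.HydrodynamicLimit` with the Jeffreys bound, the limits algebra, the statics of the reference
and the entropy dock all proved inside the term — not meters it; (ii) 'closure in the mean suffices'
becomes a statics-free theorem — any engine that outputs one-particle-marginal moments (BBGKY/Enskog
duality, kinetic windows, covariance/Duhamel forms) closes the guarded Yau target
RelEntropyVanishingInBand (stmt-17396; 0766 before rev 4) by proving two MEAN statements of the same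
kind, with no partition-function asymptotics, no entropy functional and no Gibbs–Duhem/isentropy
identity to formalise; (iii) it types the reversed problem explicitly, so the VelocityReversal moral
(convergence at t as strong as at 0 is admissible exactly when the macroscopic law is reversible —
classical Euler, Spohn1991 I §3.2) is a load-bearing hypothesis, not a caveat. Negatives index (3
HydrodynamicLimit entries: 9168 adjoint-Enskog test family, 9236/9238 degenerate ball quantifiers)
is untouched: no item here quantifies over radii/fractions, and every law carries its
probability-measure guard and LLN tie. STATEMENT RE-TYPE (D-0032, p126922) — rev 4: the conjunct is
now PACKING-GUARDED (∃ η₀ outermost; ∀ t ∈ [0,T) ∀ x, ρ_t(x)σ³ < η₀ after the solution hypothesis)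
and every 0766-format item here was re-typed in exactly that format (Forward/Backward/Statics: guard
inserted, old ⇒ new with η₀ := 1; target 0766 ↦ guarded twin 17396; Assembly 9240 ↦ guarded dock
17397): the implosion / close-packing over-strength rev 1–3 flagged on every item is gone, and the
route meets the board's guarded MEAN engines (MeanHydroLimitInBand of AthermalClockWard /
ResponseRigidity) in their regime.

RANKED CRUXES. #0 RelEntropyVanishingInBand (target) — the shared GUARDED typed Yau target
(stmt-17396 = 0766 with the Statement's guard; shared with FluxGibbsianityLdDrude, AnosovDiceHopf,
BGEndpointRigidity): ∃ η₀ > 0 such that for all continuous profiles ∃ σ₀ ∀ σ<σ₀ ∀ classical hs-Euler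
solutions on [0,T) whose local packing stays below η₀ ∀ flows: the local Gibbs laws are probability
measures and, if their fields converge at t = 0, then ∀ t < T ∃ activity profile a_t such that the
reference local Gibbs law (a_t, u_t, θ_t) is a probability measure whose empirical fields
concentrate exponentially around (ρ, ρu, E)(t), and klDiv(lawAt Φ_N (localGibbs a₀u₀θ₀) t ‖
localGibbs a_t u_t θ_t)/(N+1) → 0. Here it is PRODUCED inside `closes` (rev 8: `hR :
RelEntropyVanishingInBand :=
Theorems.EntropyClockDock.relEntropyVanishingInBand_of_gronwallCoreInBand <core from the two
cruxes>`, so the decl is in the cone of the deciding theorem), not a binder and not an independent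
obligation; 0766 ⇒ 17396 (η₀ := 1). (why it might fail: entropy production ≥ cN before the first
shock INSIDE the dilute band for some smooth data would close every entropy route; the guard removes
only the implosion/close-packing over-strength of 0766.) [Yau1991, OllaVaradhanYau1993,
Varadhan1993EntropyMethods]
#2 ForwardMeanHydro (crux) — HYDRODYNAMICS IN THE MEAN, FORWARD, IN THE DILUTE BAND (card Mechanism
5 / retired MeanEntropyPairing, widened from the one entropy-variable statistic to all tilts; rev 4:
the Statement's packing guard inserted, stmt-13649 ⇒ this with η₀ := 1): there is η₀ > 0 such that
for continuous a₀, θ₀ > 0, u₀ there is σ₀ > 0 such that for 0 < σ < σ₀, every classical hs-Euler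
solution (ρ,u,θ) on [0,T) with ρ_t(x)σ³ < η₀ on [0,T) × 𝕋³, every flow family Φ_N with the local
Gibbs laws f₀ = localGibbsLaw σ a₀ u₀ θ₀ probability measures and fields converging at t = 0, every
t ∈ [0,T) and every continuous tilt (ξ_ρ, ξ_e, ξ_m): E_f₀[ tiltStatistic ξ_ρ ξ_e ξ_m (Φ_N(t) z) ] →
∫ ( ξ_ρ ρ_t + ρ_t⟨ξ_m, u_t⟩ + ξ_e E_t ) dx, E = totalEnergyDensity. Only the (1, v, |v|²/2)-moments
of the ONE-particle marginal are involved; no fluctuation, block or two-marginal statement.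
[difficulty: open-problem] (why it might fail: it is the conjunct's closure content in the mean at
fixed σ inside the dilute band: an Euler-order anomaly of the mean momentum/heat flux of
deterministic spheres (no mixing theorem at fixed density, Spohn1991 I.3) breaks it; free flight
fails it (phase mixing of shear/entropy waves).) [Spohn1991, Yau1991, OllaVaradhanYau1993,
KipnisLandim1999, Literature.Barriers.AtomisticToContinuum.BoltzmannHypothesisBarrierNarrow,
Literature.Barriers.AtomisticToContinuum.HighMomentumCutoffBarrierNarrow]
#3 BackwardMeanHydro (crux) — HYDRODYNAMICS IN THE MEAN FOR THE TARGET, RUN BACKWARDS, IN THE DILUTE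
BAND (the card's mirror move made load-bearing; rev 4: guard inserted, stmt-13650 ⇒ this with η₀ :=
1): with the quantifiers of ForwardMeanHydro (its own η₀, σ₀; guarded solutions), for every t ∈
[0,T) and every continuous activity profile a > 0 such that ψ_t := localGibbsLaw σ a (u t) (θ t) is
a probability measure for all N whose fields at time 0 converge to (ρ_t, ρ_t u_t, E_t): for every s
∈ [0,t] and every continuous tilt, E_ψ_t[ tiltStatistic ξ (Φ_N(−s) z) ] → ∫ ( ξ_ρ ρ_(t−s) +
ρ_(t−s)⟨ξ_m, u_(t−s)⟩ + ξ_e E_(t−s) ) dx. By flow_flipVel_ae + tiltStatistic_flipVel + R_#LG(a,u,θ)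
= LG(a,−u,θ) this is FORWARD mean hydrodynamics of the mirrored target LG(a, −u_t, θ_t), whose
classical Euler solution is s ↦ R̂P_(t−s) (compressible Euler is invariant under (t,u) ↦ (−t,−u)),
including the closed endpoint s = t where it lands on R̂P₀; `closes` uses the instances s = 0 (with
the λ_t-tilt; the LLN hypothesis of ψ_t at time 0 is the tree's reference tie
EntropyClockDock.tie_rhoLim_of_smallDensity) and s = t (with the λ₀-tilt). [deps: ForwardMeanHydro]
[difficulty: open-problem] (why it might fail: needs η₀, σ₀ uniform over all targets P_t reached
from the data and mean closure up to the CLOSED endpoint s = t of the reversed classical solution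
(backward continuation, Kato1975); any closure anomaly that breaks ForwardMeanHydro breaks it too —
it cannot be easier than the conjunct for mirrored data.) [Spohn1991, CIPDiluteGases1994,
EvansSearlesWilliams2016, BreschJabinSoler2025, Kato1975,
Literature.Barriers.AtomisticToContinuum.VelocityReversalBarrier]
#9 HydroLimitForcesForward (support) — CERTIFICATE THAT THE RANK-2 CRUX IS A SHADOW OF THE CONJUNCT:
_root_.HydrodynamicLimit → ForwardMeanHydro (Statement decl by name; text of stmt-13653 unchanged,
both sides packing-guarded since the re-type, so rev 4 restores its meaning: guarded conjunct ⇒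
guarded mean hydrodynamics; its informal gloss 'abbrev of the Literature constant' predates the
re-type). Proof: η₀, σ₀ from the conjunct; convergence in probability of the fields at t (χ = ξ_ρ,
components of ξ_m, ξ_e; tiltStatistic_eq_fields) upgrades to convergence in mean by uniform
integrability: |tiltStatistic| ≤ C(1 + kinetic energy per particle), conserved on good orbits
(configEnergy_eq_holds) with N-uniformly bounded second moment under local Gibbs laws. Hence
¬ForwardMeanHydro for some datum refutes the conjunct for it. (The Backward analogue needs Euler
reversal + backward continuation past the closed endpoint, Kato1975/Majda1984 — Two-layer plan G1,
not filed.) [difficulty: M] [OllaVaradhanYau1993, KipnisLandim1999, Spohn1991]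
#1 Assembly (assembly) — THE GUARDED ENTROPY DOCK (shared stmt-17397 =
FluxGibbsianityLdDrude.EntropyToFieldsInBand): RelEntropyVanishingInBand → _root_.HydrodynamicLimit;
provable-now (8 lines over Theorems.tendstoHydroFieldsAt_of_klDiv, candidate proofs attached as
evidence by grounders); since rev 9 it is NOT a hypothesis of `closes` (its content is re-proved
inside the term) and stays listed only as the shared dock other Yau-target routes attach to.
[difficulty: provable-now] [Yau1991, KipnisLandim1999]
DROPPED AS ITEMS IN REV 9 (route-repair, glue.non-crux-hypothesis): JeffreysIdentity (13651),
TargetGibbsStatics (17769), TwoSidedClosure (17770) and LoschmidtZermelo (12337) — the first three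
because their content is now PROVED inside `closes` (Jeffreys as the bound KL(f_t‖ψ_t).toReal ≤ J_N
for σ ≤ 1/2 from Theorems.toReal_klDiv_lawAt_localGibbsLaw_sub + the echo Theorems.klDiv_lawAt_eq +
EntropyClockDock.ae_logRatio_eq_oneBody + QuenchedCellClock.stub_klDivLawAtLocalGibbsNeTop; the
statics by Theorems.EntropyClockDock.relEntropyVanishingInBand_of_gronwallCoreInBand +
tie_rhoLim_of_smallDensity; the limits algebra verbatim; the dock by
Theorems.tendstoHydroFieldsAt_of_klDiv), the meter because it is not part of the deciding argument
(it stays the card's MD observable, see CHEAPEST FALSIFIER). Items after rev 9: 5 (1 target, 2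
cruxes, 1 support, 1 assembly).

TWO-LAYER PLAN. Foreseen, not filed. (G1) BackwardMeanHydro ⇐ ForwardGeneralData →
EulerReversalContinuation → MirrorDictionary → BackwardMeanHydro (k = 3): ForwardGeneralData =
ForwardMeanHydro with η₀, σ₀ uniform over a C⁰-compact family of profiles; EulerReversalContinuation
= a guarded classical hs-Euler solution on [0,T), 0 < t < T, yields a classical Q on [0, t+ε) with
Q_s = (ρ, −u, θ)(t−s) on [0,t] (Euler reversibility under (t,u) ↦ (−t,−u) + backward local
well-posedness at small packing, Kato1975, Majda1984, HsEosLowDensity 0768); MirrorDictionary =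
E_LG(a,u,θ)[F∘Φ_(−s)] = E_LG(a,−u,θ)[F∘flipVel∘Φ_s] (ae_flow_flipVel_localGibbsLaw,
tiltStatistic_flipVel — provable now). (G2) ForwardMeanHydro ⇐ MeanFluxClosure → MeanGronwall →
ForwardMeanHydro (k = 2): d/dt E_f_t[tilt] = E_f_t[streaming + collisional-transfer flux paired with
∇ξ] exactly (first BBGKY equation in the mean); MeanFluxClosure = expected flux = Euler flux of the
expected fields + o(1) pre-shock in the dilute band (where an engine — OneFlightGossipEngine,
EnskogAdjointDuality, StiffCollisionalRelaxation, kinetic windows, the guarded MeanHydroLimitInBand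
routes — plugs in); MeanGronwall = weak-topology stability of classical Euler closes the mean fields
onto P_t. (G3) retired in rev 9: the statics of the reference are in the tree
(exists_activity_of_density, uniformLocalGibbsConcentration_proof, tie_rhoLim_of_smallDensity,
packaged by relEntropyVanishingInBand_of_gronwallCoreInBand) and used inside `closes`. No third
layer.

KILL CRITERIA. ¬ForwardMeanHydro for some smooth datum in the dilute band (a theorem, or certified
event-driven MD showing an N-independent defect of an expected tilt statistic before the shock time)
closes the route `refuted:ForwardMeanHydro` AND, through HydroLimitForcesForward, is evidence
against HydrodynamicLimit for that datum (file ¬HydrodynamicLimitFor). ¬BackwardMeanHydro with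
ForwardMeanHydro standing forces a PIVOT, not a close: replace the backward crux by the one-sided
statics package of entropy-saturation-mean-closure (canonical entropy asymptotics + isentropy) — the
route degrades to entropy saturation and says so. The statics, the Jeffreys bound, the limits
algebra and the dock are PROVED (inside `closes`, rev 9), so no kill can come from them any more;
the route now stands or falls with its two cruxes exactly. RelEntropyVanishingInBand (or the
stronger 0766) proved by any route moots both cruxes (they become corollaries:
HydroLimitForcesForward, and Backward via G1); HydrodynamicLimit proved elsewhere moots everything
but the identities.

NOT DECOMPOSED YET. (a) The closure engine behind ForwardMeanHydro (G2) — deliberately not chosen: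
the route's content is that ANY mean-level engine suffices, so the split waits for the first engine
route to move; (b) the backward certificate (G1) — filed only if a refuter doubts that
BackwardMeanHydro is a shadow of the conjunct; (c) nothing static remains (G3 retired, rev 9); (d)
the card's onset/crossover physics (D_N(t) leaves the free parabola ½𝔞₀t² for the Euler parabola
½𝔞₀ᴱt² after O(Kn), finite-N O(Kn)|t| cusp) stays an MD falsifier, not an item; (e) post-shock:
J_N(t)/(N+1) ≥ H/(N+1) → Δs > 0 past T* — the target is pre-shock by design, nothing filed; (f) the
card's exact identities — Mirror–Jeffreys for all σ > 0 under the two probability guards (ex-item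
13651; `closes` proves and uses only the bound at σ ≤ 1/2), Loschmidt–Zermelo H(f_t‖R_#f_t) =
H(f_2t|f₀) (ex-item 12337), DissipationIdentity — ride as remarks; a prover who wants them lands
them as `--supports` lemmas, they are not obligations of the route.

CHEAPEST FALSIFIER. Formal (desk, done): JeffreysIdentity at t = 0 with ψ = f₀ reads 0 + 0 = (N+1)·0
✓; at global equilibrium (constant profiles, u₀ = 0, a = a₀) f_t = f₀ and both sides vanish ✓; free
flight: ForwardMeanHydro is FALSE (phase mixing of shear/entropy waves) and J/(N+1) →
2·(entropy-variable mismatch) > 0 — the criterion correctly refuses the ideal gas ✓. Cheapest real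
test (MD, one ensemble average each, no Euler solver beyond P_t): rest data a₀ ≡ 1, θ₀ = 1 + 0.3 cos
2πx₁, φ ≈ 0.05–0.1 (dilute band), N = 10⁵–10⁶; measure the forward bracket E_f₀[Λ₀ − Λ_t∘Φ_t] and,
from a run started at the MIRRORED target LG(a_t, −u_t, θ_t), the backward bracket E[Λ_t^mirror −
Λ₀∘Φ_t]; each must tend to ±(⟨λ₀,P₀⟩ − ⟨λ_t,P_t⟩) and their SUM to 0: an N-independent positive sum
before the shock time kills ForwardMeanHydro ∧ BackwardMeanHydro (and, by HydroLimitForcesForward,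
the conjunct for these data). Single-run version (rest data, the Loschmidt–Zermelo identity): D_N(t)
= E Λ₀ − E[Λ₀∘Φ_t] must bend from the free curve to the Euler parabola after O(Kn).

NUMBERS. Entropy-variable tilt of (a,u,θ): λ = (log a − (3/2)log 2πθ − |u|²/2θ, u/θ, −1/θ), so log
localGibbsProfile a u θ (x,v) = λ_ρ(x) + ⟨λ_m(x),v⟩ + λ_e(x)|v|²/2 exactly (localMaxwellian 1 θ u,
finrank 3). J_N(t)/(N+1) = E_f₀[Λ₀ − Λ_t∘Φ_t] + E_ψ_t[Λ_t − Λ₀∘Φ_(−t)] ≥ max(H(f_t|ψ_t),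
H(ψ_t|f_t))/(N+1) ≥ 0; under the conjunct each bracket → ±(⟨λ₀,P₀⟩ − ⟨λ_t,P_t⟩). MD-falsifier onset
numbers (rest data, σ → 0): free 𝔞₀ = ∫a₀[θ₀|∇log a₀|² + 2∇log a₀·∇θ₀ + (7/2)|∇θ₀|²/θ₀], Euler 𝔞₀ᴱ =
∫|∇p₀|²/(ρ₀θ₀), gap (5/2)∫ρ₀|∇θ₀|²/θ₀; Kn ≍ (N+1)^(−1/3)/σ². Items: 9 at open and after rev 4 (1
target, 2 cruxes, 5 supports, 1 assembly); 5 after rev 9 (1 target, 2 cruxes, 1 support —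
HydroLimitForcesForward, the necessity certificate of crux #2 — and the shared assembly dock),
deciding theorem crux-only. Guard: φ = (π/6)ρσ³, so ρσ³ < η₀ reads φ < (π/6)η₀; η₀'s combine by min.

DEFINITION REQUESTS. None. Every constant (localGibbsLaw, localGibbsProfile,
HardSphereFlow.lawAt/flow, flipVel, empiricalMeasure, InformationTheory.klDiv, TendstoHydroFieldsAt,
totalEnergyDensity, empirical*Field) is in the Statement's own cone; since rev 8 the route file ALSO
imports two landed, sorry-free Theorems modules for the proof of `closes`
(Summits.AtomisticToContinuum.HydrodynamicLimit.Theorems.ImplosionDichotomyHydroLimitInBandCoreReduction,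
….Theorems.TwoClocksClampedEntropyClockKlDivLawAtLocalGibbsNeTop; staffability's deps_unproved is
computed on the used-constants cone, which stays proved) — rev 2 had dropped
HardSphereTwoTimePressure and its Sweep1 cone. The tilt statistic ⟨ξ, F(z)⟩ is INLINE in
ForwardMeanHydro / BackwardMeanHydro (and in the Jeffreys bracket inside `closes`) as ∫ (ξ_ρ(x) +
⟨ξ_m(x), v⟩ + ξ_e(x)|v|²/2) d(empiricalMeasure z)(x, v) = KineticTheory.tiltStatistic ξ_ρ ξ_e ξ_m z
by rfl (EquivCheck.lean, rev 2); PROVERS import HardSphereTwoTimePressure in their Theorems files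
for tiltStatistic_eq_fields / tiltStatistic_flipVel / measurable_tiltStatistic and the reversal
lemmas measurePreserving_flipVel_localGibbsLaw / ae_flow_flipVel_localGibbsLaw / flow_flipVel_ae.
Bib: BreschJabinSoler2025 (commit 88860ffa35d8).

Novelty: Searches (2026-08-15): `lit search --source crossref "symmetrized relative entropy Jeffreys
divergence kinetic hydrodynamic limit"` (15 rows: Varadhan 1993 'Relative entropy and hydrodynamic
limits' doi:10.1007/978-1-4615-7909-0_37; Kosygina2001 doi:10.1214/aop/1015345597 (specific entropy
in the hydrodynamic limit, stochastic); Jeffreys-divergence computational papers; nothing two-sided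
for particle systems); `lit search --source crossref "A new approach to the mean-field limit of
Vlasov-Fokker-Planck Bresch Jabin Soler"` (→ BreschJabinSoler2025 doi:10.2140/apde.2025.18.1037, the
reverse relative entropy H(f^⊗N | f_N) in mean-field limits; Bresch–Jabin–Wang modulated free energy
doi:10.1215/00127094-2022-0088); `lit search --source crossref "time reversal symmetric relative
entropy production local equilibrium Euler deterministic particle dynamics"` (12 rows, noise); `lit
galaxy search "symmetrized relative entropy" --star all` (7 rows, bioinformatics noise) and
`"relative entropy with respect to the true" --star pdf` (0); local/hybrid `lit search` and
arXiv/OpenAlex cascades unavailable this session (rc 75 / HTTP 429, logged); the base planner's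
searches for the card (ESW2016 book Ch. 3 read: dissipation function Ω_t, ⟨Ω_t⟩ = KL against the
evolved law; crossref sweeps on Evans–Searles) and the refuters' AUDIT-11 / route-review priors are
inherited; on the board: all 26 open route files grepped for flipVel/reversal/klDiv (none uses the
mirror), cards entropy-saturation-mean  [refs: 10.1007/978-1-4615-7909-0_37, 10.1214/aop/1015345597, 10.2140/apde.2025.18.1037, 10.1215/00127094-2022-0088, 10.1002/9783527695782, doi:10.1007/978-1-4615-7909-0_37, doi:10.1214/aop/1015345597, doi:10.2140/apde.2025.18.1037, doi:10.1215/00127094-2022-0088, doi:10.1002/9783527695782, Kosygina2001, BreschJabinSoler2025, EvansSearlesWilliams2016, EvansSearles2002, KawaiParrondoVandenBroeck2007, Yau19]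

Barriers (technique_class: relative-entropy, time-reversal, jeffreys-divergence): - technique_class: relative-entropy, time-reversal, jeffreys-divergence
- Literature.Barriers.AtomisticToContinuum.VelocityReversalBarrier: used as a RESOURCE, not met as
an obstruction — nothing is claimed for every phase point or along every orbit (laws, expectations,
klDiv); reversibility enters only Liouville-a.e. (flow_flipVel_ae / ae_flow_flipVel_localGibbsLaw),
which the barrier's kernel notes is the only form available for colliding flows; and
BackwardMeanHydro asks for convergence 'at time t as strong as at time 0' precisely in the case the
barrier ALLOWS it: the macroscopic law (classical compressible Euler, pre-shock) is itself
reversible (Spohn1991 I §3.2), so Spohn's immediate counterexample does not arise.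
- Literature.Barriers.AtomisticToContinuum.VelocityReversalBarrierNarrow: same; no sure derivation,
no monotone observable along orbits (J_N is a functional of LAWS and is not claimed monotone).
- Literature.Barriers.AtomisticToContinuum.BoltzmannHypothesisBarrier: APPLIES to both cruxes —
closure of the mean fluxes at fixed σ is a dynamical local-equilibrium input and the route does not
manufacture it; it does not evade it; the bet is that the mean / one-particle-marginal level is the
weakest form every engine must deliver anyway, and the route proves it SUFFICIENT without block
laws, stationary-state classification, fluctuation bounds or thermodynamic formalism. The barrier's
ideal-gas kernel is respected (free flight fails ForwardMeanHydro; J/(N+1) ↛ 0).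
-

History (route lifecycle, newest last):
- 2026-08-15T19:30:42Z · rev 2: restated ForwardMeanHydro (stmt-AtomisticToContinuum-12332), BackwardMeanHydro (stmt-AtomisticToContinuum-12333), JeffreysIdentity (stmt-AtomisticToContinuum-12334), TwoSidedClosure (stmt-AtomisticToContinuum-12336), HydroLimitForcesForward (stmt-AtomisticToContinuum-12338) — route-repair (cone guardrail): drop  (planner-rrepair-AtomisticToContinuum-MirrorJef-d1b9ab7b-0)
- 2026-08-16T03:47:39Z · AUTO-CRUX (backfill): RelEntropyVanishing — hypotheses of the deciding theorem that nothing in the route derives are cruxes (operator:999:586464)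
- 2026-08-16T16:43:03Z · AUTO-CRUX (backfill): RelEntropyVanishing — hypotheses of the deciding theorem that nothing in the route derives are cruxes (operator:999:1813213)
- 2026-08-16T23:35:08Z · rev 4: restated ForwardMeanHydro (stmt-AtomisticToContinuum-13649), BackwardMeanHydro (stmt-AtomisticToContinuum-13650), TargetGibbsStatics (stmt-AtomisticToContinuum-12335), TwoSidedClosure (stmt-AtomisticToContinuum-13652), Assembly (stmt-AtomisticToContinuum-9240 proved) — route-repair (statement-revised p126922; un (planner-rrepair-AtomisticToContinuum-MirrorJef-8c57d197-0)
- 2026-08-16T23:35:08Z · rev 4: dropped stmt-AtomisticToContinuum-0766 — route-repair (statement-revised p126922; unit rrepair-AtomisticToContinuum-MirrorJef-8c57d197): re-typed the route's 0766-format items in the re-typed Statement (planner-rrepair-AtomisticToContinuum-MirrorJef-8c57d197-0)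
- 2026-08-17T00:28:15Z · rev 9: dropped TwoSidedClosure, JeffreysIdentity, TargetGibbsStatics, LoschmidtZermelo — route-repair (glue.non-crux-hypothesis → CRUX-ONLY): closes : ForwardMeanHydro → BackwardMeanHydro → _root_.HydrodynamicLimit, nothing else assumed — the Mirror (planner-rbadge-AtomisticToContinuum-MirrorJeff-d1b9ab7b-0)
- 2026-08-24T00:16:51Z · DORMANT — reconciler: no traction for 6.4 d (last activity item-evidence-added at 2026-08-17T14:51:42Z); parked, not closed — `ledger route dormant route-AtomisticToConti (operator:999:1407657)

sub-problem: HydrodynamicLimit · status: dormant · opened planner-plancard-AtomisticToContinuum-Hydrody-ba59d0f1-g2-0 2026-08-15T18:53:14Z · rev 9 · ledger route-AtomisticToContinuum-MirrorJeffreys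
GENERATED by the gate from the ledger (D-0016/17). Provers cite these decls: `theorem foo : Summit.AtomisticToContinuum.HydrodynamicLimit.Theses.MirrorJeffreys.<Decl> := …` in Summits/AtomisticToContinuum/HydrodynamicLimit/Theorems/<Name>.lean.
-/

namespace Summit.AtomisticToContinuum.HydrodynamicLimit.Theses.MirrorJeffreys

open scoped BigOperators Topology Manifold Classical MeasureTheory ProbabilityTheory Matrix InnerProductSpace ComplexConjugate ContinuousMap
open Filter Set Function TopologicalSpace MeasureTheory

attribute [summit_statement] _root_.HydrodynamicLimit

/-- item stmt-AtomisticToContinuum-17396 · target · rank 0 · open · by planner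
why it might fail: Entropy production ≥ cN before the first shock INSIDE the dilute band for some smooth data would close every entropy route; the guard removes only the implosion / close-packing over-strength of 0766.
sources: Yau1991, OllaVaradhanYau1993, Varadhan1993EntropyMethods
[target] PACKING-GUARDED X_RE — the shared Yau-form target stmt-AtomisticToContinuum-0766 made to
match the RE-TYPED conjunct (Statement retype p126922, 2026-08-16: `_root_.HydrodynamicLimit` is now
the packing-guarded limit, ∃ η₀ outermost, guard ∀ t ∈ [0,T) ∀ x, ρ_t(x)σ³ < η₀ after the solution
hypothesis): there is η₀ > 0 (prover-chosen) such that for all continuous positive profiles ∃ σ₀ ∀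
0<σ<σ₀ ∀ T ∀ classical hs-Euler solutions (ρ,u,θ) on [0,T) WHOSE LOCAL PACKING STAYS BELOW η₀ ∀ flow
families Φ: the initial local Gibbs laws are probability measures and, if their empirical fields
converge at t = 0, then ∀ t < T ∃ activity profile a_t such that the reference local Gibbs law (a_t,
u_t, θ_t) is a probability measure whose density/momentum/energy fields concentrate exponentially (≤
C e^{-(N+1)/C}) around (ρ, ρu, E)(t) and klDiv(lawAt Φ_N (localGibbs a₀ u₀ θ₀) t ‖ localGibbs a_t
u_t θ_t)/(N+1) → 0. CANONICAL FORM: 0766 verbatim with the Statement's guard clause inserted at the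
Statement's position and `∃ η₀ : ℝ, 0 < η₀ ∧` prefixed — sibling Yau-family routes re-targeting
after the retype should attach to THIS signature (dedup). 0766 ⇒ this (take η₀ := 1 and ignore the
guard; Ske -/
@[route_item "route-AtomisticToContinuum-MirrorJeffreys"]
def RelEntropyVanishingInBand : Prop :=
  ∃ η₀ : ℝ, 0 < η₀ ∧ ∀ (a₀ θ₀ : Literature.MathematicalPhysics.KineticTheory.T3 → ℝ) (u₀ : Literature.MathematicalPhysics.KineticTheory.T3 → Literature.MathematicalPhysics.KineticTheory.V3), Continuous a₀ → Continuous θ₀ → Continuous u₀ → (∀ x, 0 < a₀ x) → (∀ x, 0 < θ₀ x) → ∃ σ₀ : ℝ, 0 < σ₀ ∧ ∀ σ : ℝ, 0 < σ → σ < σ₀ → ∀ (T : ℝ) (ρ θ : ℝ → Literature.MathematicalPhysics.KineticTheory.T3 → ℝ) (u : ℝ → Literature.MathematicalPhysics.KineticTheory.T3 → Literature.MathematicalPhysics.KineticTheory.V3), Literature.MathematicalPhysics.KineticTheory.IsHardSphereEulerSolution σ T ρ u θ → (∀ t ∈ Set.Ico 0 T, ∀ x, ρ t x * σ ^ 3 <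 η₀) → ∀ Φ : (N : ℕ) → Literature.Analysis.FluidPDE.HardSphereFlow (Literature.Analysis.FluidPDE.Torus.geometry (Fin 3)) (Literature.MathematicalPhysics.KineticTheory.hsDiameter σ N) (N + 1), (∀ N, MeasureTheory.IsProbabilityMeasure (Literature.MathematicalPhysics.KineticTheory.localGibbsLaw σ a₀ u₀ θ₀ N (Φ N))) ∧ (Literature.MathematicalPhysics.KineticTheory.TendstoHydroFieldsAt (fun N => Literature.MathematicalPhysics.KineticTheory.localGibbsLaw σ a₀ u₀ θ₀ N (Φ N)) Φ ρ u θ 0 → ∀ t ∈ Set.Ico 0 T, ∃ a : Literature.MathematicalPhysics.KineticTheory.T3 → ℝ, (∀ N, MeasureTheory.IsProbabilityMeasure (Literature.MathematicalPhysics.KineticTheory.localGibbsLaw σ a (u t) (θ t) N (Φ N))) ∧ (∀ χ : Literature.MathematicalPhysics.KineticTheory.T3 → ℝ, Continuous χ → ∀ δ : ℝ, 0 < δ → ∃ C : ℝ, 0 < C ∧ ∀ N : ℕ, Literature.MathematicalPhysics.KineticTheory.localGibbsLaw σ a (u t) (θ t) N (Φ N) {z | δ < |Literature.MathematicalPhysics.KineticTheory.empiricalDensityField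 z χ - ∫ x, χ x * ρ t x|} ≤ ENNReal.ofReal (C * Real.exp (-(C⁻¹ * (N + 1)))) ∧ Literature.MathematicalPhysics.KineticTheory.localGibbsLaw σ a (u t) (θ t) N (Φ N) {z | δ < ‖Literature.MathematicalPhysics.KineticTheory.empiricalMomentumField z χ - ∫ x, (χ x * ρ t x) • u t x‖} ≤ ENNReal.ofReal (C * Real.exp (-(C⁻¹ * (N + 1)))) ∧ Literature.MathematicalPhysics.KineticTheory.localGibbsLaw σ a (u t) (θ t) N (Φ N) {z | δ < |Literature.MathematicalPhysics.KineticTheory.empiricalEnergyField z χ - ∫ x, χ x * Literature.MathematicalPhysics.KineticTheory.totalEnergyDensity (ρ t x) (u t x) (θ t x)|} ≤ ENNReal.ofReal (C * Real.exp (-(C⁻¹ * (N + 1))))) ∧ Filter.Tendsto (fun N : ℕ => InformationTheory.klDiv ((Φ N).lawAt (Literature.MathematicalPhysics.KineticTheory.localGibbsLaw σ a₀ u₀ θ₀ N (Φ N)) t) (Literature.MathematicalPhysics.KineticTheory.localGibbsLaw σ a (u t) (θ t) N (Φ N)) / ((N : ENNReal) + 1)) Filter.atTop (nhds 0))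

-- earlier ForwardMeanHydro (stmt-AtomisticToContinuum-12332, replaced 2026-08-15T19:30:42Z -> stmt-AtomisticToContinuum-13649): retired by None — ∀ (a₀ θ₀ : Literature.MathematicalPhysics.KineticTheory.T3 → ℝ) (u₀ : Literature.MathematicalPhysics.KineticTheory.T3 → Literature.MathematicalPhysics.KineticTheory.V3), Continuous a₀ → Continuous θ₀ → Continuous u₀ → (∀ x, 0 < a₀ x) → (∀ x, 0 < θ₀ x) → ∃ 
-- earlier ForwardMeanHydro (stmt-AtomisticToContinuum-13649, replaced 2026-08-16T23:35:08Z -> stmt-AtomisticToContinuum-17767): retired by None — ∀ (a₀ θ₀ : Literature.MathematicalPhysics.KineticTheory.T3 → ℝ) (u₀ : Literature.MathematicalPhysics.KineticTheory.T3 → Literature.MathematicalPhysics.KineticTheory.V3), Continuous a₀ → Continuous θ₀ → Continuous u₀ → (∀ x, 0 < a₀ x) → (∀ x, 0 < θ₀ x) → ∃ 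
/-- item stmt-AtomisticToContinuum-17767 · crux · rank 2 · open · by planner
why it might fail: The conjunct's closure content in the mean at fixed σ inside the dilute band: an Euler-order anomaly of the mean momentum/heat flux of deterministic spheres (no mixing theorem at fixed density, Spohn1991 I.3) breaks it; free flight fails it (phase mixing of shear/entropy waves).
sources: Spohn1991, Yau1991, OllaVaradhanYau1993, KipnisLandim1999, Literature.Barriers.AtomisticToContinuum.BoltzmannHypothesisBarrierNarrow, Literature.Barriers.AtomisticToContinuum.HighMomentumCutoffBarrierNarrow
[crux] HYDRODYNAMICS IN THE MEAN, FORWARD, IN THE DILUTE BAND (card Mechanism 5 / retired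
MeanEntropyPairing, widened from the one entropy-variable statistic to all tilts; rev 4
(route-repair 2026-08-16 after the Statement re-type p126922, D-0032): the Statement's packing guard
`∀ t ∈ Set.Ico 0 T, ∀ x, ρ t x * σ ^ 3 < η₀` inserted at the Statement's position and `∃ η₀ : ℝ, 0 <
η₀ ∧` prefixed (prover-chosen threshold, ∃ outermost); the former unguarded item implies this one
(η₀ := 1, guard ignored — Sketch.lean rc 0), formerly stmt-AtomisticToContinuum-13649): there is η₀
> 0 such that for continuous a₀, θ₀ > 0, u₀ there is σ₀ > 0 such that for 0 < σ < σ₀, every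
classical hs-Euler solution (ρ,u,θ) on [0,T) WHOSE LOCAL PACKING STAYS BELOW η₀ (∀ t ∈ [0,T) ∀ x,
ρ_t(x)σ³ < η₀), every flow family Φ_N with the local Gibbs laws f₀ = localGibbsLaw σ a₀ u₀ θ₀
probability measures and fields converging at t = 0, every t ∈ [0,T) and every continuous tilt (ξ_ρ,
ξ_e, ξ_m): E_f₀[ ⟨ξ, F(Φ_N(t) z)⟩ ] → ∫ ( ξ_ρ ρ_t + ρ_t⟨ξ_m, u_t⟩ + ξ_e E_t ) dx, E =
totalEnergyDensity; tilt statistic written INLINE as ⟨ξ,F(z)⟩ = ∫ (ξ_ρ(x) + ⟨ξ_m(x),v⟩ +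
ξ_e(x)|v|²/2) dμ_z(x,v) against Literature.Analysis.FluidPDE.e -/
@[route_item "route-AtomisticToContinuum-MirrorJeffreys", crux]
def ForwardMeanHydro : Prop :=
  ∃ η₀ : ℝ, 0 < η₀ ∧ ∀ (a₀ θ₀ : Literature.MathematicalPhysics.KineticTheory.T3 → ℝ) (u₀ : Literature.MathematicalPhysics.KineticTheory.T3 → Literature.MathematicalPhysics.KineticTheory.V3), Continuous a₀ → Continuous θ₀ → Continuous u₀ → (∀ x, 0 < a₀ x) → (∀ x, 0 < θ₀ x) → ∃ σ₀ : ℝ, 0 < σ₀ ∧ ∀ σ : ℝ, 0 < σ → σ < σ₀ → ∀ (T : ℝ) (ρ θ : ℝ → Literature.MathematicalPhysics.KineticTheory.T3 → ℝ) (u : ℝ → Literature.MathematicalPhysics.KineticTheory.T3 → Literature.MathematicalPhysics.KineticTheory.V3), Literature.MathematicalPhysics.KineticTheory.IsHardSphereEulerSolution σ T ρ u θ → (∀ t ∈ Set.Ico 0 T, ∀ x, ρ t x * σ ^ 3 < η₀) → ∀ Φ : (N : ℕ) → Literature.Analysis.FluidPDE.HardSphereFlow (Literature.Analysis.FluidPDE.Torus.geometry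 (Fin 3)) (Literature.MathematicalPhysics.KineticTheory.hsDiameter σ N) (N + 1), (∀ N, IsProbabilityMeasure (Literature.MathematicalPhysics.KineticTheory.localGibbsLaw σ a₀ u₀ θ₀ N (Φ N))) → Literature.MathematicalPhysics.KineticTheory.TendstoHydroFieldsAt (fun N => Literature.MathematicalPhysics.KineticTheory.localGibbsLaw σ a₀ u₀ θ₀ N (Φ N)) Φ ρ u θ 0 → ∀ t ∈ Set.Ico 0 T, ∀ (lρ le : Literature.MathematicalPhysics.KineticTheory.T3 → ℝ) (lm : Literature.MathematicalPhysics.KineticTheory.T3 → Literature.MathematicalPhysics.KineticTheory.V3), Continuous lρ → Continuous le → Continuous lm → Filter.Tendsto (fun N : ℕ => ∫ z, (∫ y, (lρ y.1 + @inner ℝ _ _ (lm y.1) y.2 + le y.1 * (‖y.2‖ ^ 2 / 2)) ∂Literature.Analysis.FluidPDE.empiricalMeasure ((Φ N).flow t z)) ∂(Literature.MathematicalPhysics.KineticTheory.localGibbsLaw σ a₀ u₀ θ₀ N (Φ N))) Filter.atTop (nhds (∫ x, (lρ x * ρ t x + ρ t x * @inner ℝ _ _ (lm x) (u t x) + le x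 * Literature.MathematicalPhysics.KineticTheory.totalEnergyDensity (ρ t x) (u t x) (θ t x))))

-- earlier BackwardMeanHydro (stmt-AtomisticToContinuum-12333, replaced 2026-08-15T19:30:42Z -> stmt-AtomisticToContinuum-13650): retired by None — ∀ (a₀ θ₀ : Literature.MathematicalPhysics.KineticTheory.T3 → ℝ) (u₀ : Literature.MathematicalPhysics.KineticTheory.T3 → Literature.MathematicalPhysics.KineticTheory.V3), Continuous a₀ → Continuous θ₀ → Continuous u₀ → (∀ x, 0 < a₀ x) → (∀ x, 0 < θ₀ x) → ∃
-- earlier BackwardMeanHydro (stmt-AtomisticToContinuum-13650, replaced 2026-08-16T23:35:08Z -> stmt-AtomisticToContinuum-17768): retired by None — ∀ (a₀ θ₀ : Literature.MathematicalPhysics.KineticTheory.T3 → ℝ) (u₀ : Literature.MathematicalPhysics.KineticTheory.T3 → Literature.MathematicalPhysics.KineticTheory.V3), Continuous a₀ → Continuous θ₀ → Continuous u₀ → (∀ x, 0 < a₀ x) → (∀ x, 0 < θ₀ x) → ∃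
/-- item stmt-AtomisticToContinuum-17768 · crux · rank 3 · open · by planner
why it might fail: Needs η₀, σ₀ uniform over all targets P_t reached from the data and mean closure up to the CLOSED endpoint s = t of the reversed classical solution (backward continuation, Kato1975); any closure anomaly breaking ForwardMeanHydro breaks it too — not easier than the conjunct for mirrored data.
sources: Spohn1991, CIPDiluteGases1994, EvansSearlesWilliams2016, BreschJabinSoler2025, Kato1975, Literature.Barriers.AtomisticToContinuum.VelocityReversalBarrier
[crux] HYDRODYNAMICS IN THE MEAN FOR THE TARGET, RUN BACKWARDS, IN THE DILUTE BAND (the card's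
mirror move made load-bearing; rev 4 (route-repair 2026-08-16 after the Statement re-type p126922,
D-0032): the Statement's packing guard `∀ t ∈ Set.Ico 0 T, ∀ x, ρ t x * σ ^ 3 < η₀` inserted at the
Statement's position and `∃ η₀ : ℝ, 0 < η₀ ∧` prefixed (prover-chosen threshold, ∃ outermost); the
former unguarded item implies this one (η₀ := 1, guard ignored — Sketch.lean rc 0), formerly
stmt-AtomisticToContinuum-13650): with the quantifiers of ForwardMeanHydro (its own η₀ and σ₀;
classical solutions with ρ_t(x)σ³ < η₀ on [0,T)), for every t ∈ [0,T) and every continuous activity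
profile a > 0 such that ψ_t := localGibbsLaw σ a (u t) (θ t) is a probability measure for all N
whose fields at time 0 converge to (ρ_t, ρ_t u_t, E_t): for every s ∈ [0,t] and every continuous
tilt, E_ψ_t[ ⟨ξ, F(Φ_N(−s) z)⟩ ] → ∫ ( ξ_ρ ρ_(t−s) + ρ_(t−s)⟨ξ_m, u_(t−s)⟩ + ξ_e E_(t−s) ) dx (tilt
statistic INLINE against the empirical measure, = KineticTheory.tiltStatistic by rfl). By
flow_flipVel_ae + tiltStatistic_flipVel + R_#LG(a,u,θ) = LG(a,−u,θ) this is FORWARD mean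
hydrodynamics of the mirrored target LG(a, −u_t -/
@[route_item "route-AtomisticToContinuum-MirrorJeffreys", crux]
def BackwardMeanHydro : Prop :=
  ∃ η₀ : ℝ, 0 < η₀ ∧ ∀ (a₀ θ₀ : Literature.MathematicalPhysics.KineticTheory.T3 → ℝ) (u₀ : Literature.MathematicalPhysics.KineticTheory.T3 → Literature.MathematicalPhysics.KineticTheory.V3), Continuous a₀ → Continuous θ₀ → Continuous u₀ → (∀ x, 0 < a₀ x) → (∀ x, 0 < θ₀ x) → ∃ σ₀ : ℝ, 0 < σ₀ ∧ ∀ σ : ℝ, 0 < σ → σ < σ₀ → ∀ (T : ℝ) (ρ θ : ℝ → Literature.MathematicalPhysics.KineticTheory.T3 → ℝ) (u : ℝ → Literature.MathematicalPhysics.KineticTheory.T3 → Literature.MathematicalPhysics.KineticTheory.V3), Literature.MathematicalPhysics.KineticTheory.IsHardSphereEulerSolution σ T ρ u θ → (∀ t ∈ Set.Ico 0 T, ∀ x, ρ t x * σ ^ 3 < η₀) → ∀ Φ : (N : ℕ) → Literature.Analysis.FluidPDE.HardSphereFlow (Literature.Analysis.FluidPDE.Torus.geometry (Fin 3)) (Literature.MathematicalPhysics.KineticTheory.hsDiameter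 σ N) (N + 1), (∀ N, IsProbabilityMeasure (Literature.MathematicalPhysics.KineticTheory.localGibbsLaw σ a₀ u₀ θ₀ N (Φ N))) → Literature.MathematicalPhysics.KineticTheory.TendstoHydroFieldsAt (fun N => Literature.MathematicalPhysics.KineticTheory.localGibbsLaw σ a₀ u₀ θ₀ N (Φ N)) Φ ρ u θ 0 → ∀ t ∈ Set.Ico 0 T, ∀ a : Literature.MathematicalPhysics.KineticTheory.T3 → ℝ, Continuous a → (∀ x, 0 < a x) → (∀ N, IsProbabilityMeasure (Literature.MathematicalPhysics.KineticTheory.localGibbsLaw σ a (u t) (θ t) N (Φ N))) → Literature.MathematicalPhysics.KineticTheory.TendstoHydroFieldsAt (fun N => Literature.MathematicalPhysics.KineticTheory.localGibbsLaw σ a (u t) (θ t) N (Φ N)) Φ (fun _ => ρ t) (fun _ => u t) (fun _ => θ t) 0 → ∀ s ∈ Set.Icc 0 t, ∀ (lρ le : Literature.MathematicalPhysics.KineticTheory.T3 → ℝ) (lm : Literature.MathematicalPhysics.KineticTheory.T3 → Literature.MathematicalPhysics.KineticTheory.V3), Continuous lρ → Continuous le → Continuous lm → Filter.Tendsto (fun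 N : ℕ => ∫ z, (∫ y, (lρ y.1 + @inner ℝ _ _ (lm y.1) y.2 + le y.1 * (‖y.2‖ ^ 2 / 2)) ∂Literature.Analysis.FluidPDE.empiricalMeasure ((Φ N).flow (-s) z)) ∂(Literature.MathematicalPhysics.KineticTheory.localGibbsLaw σ a (u t) (θ t) N (Φ N))) Filter.atTop (nhds (∫ x, (lρ x * ρ (t - s) x + ρ (t - s) x * @inner ℝ _ _ (lm x) (u (t - s) x) + le x * Literature.MathematicalPhysics.KineticTheory.totalEnergyDensity (ρ (t - s) x) (u (t - s) x) (θ (t - s) x))))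

-- earlier HydroLimitForcesForward (stmt-AtomisticToContinuum-12338, replaced 2026-08-15T19:30:42Z -> stmt-AtomisticToContinuum-13653): retired by None — Literature.MathematicalPhysics.KineticTheory.HydrodynamicLimit → ForwardMeanHydro
/-- item stmt-AtomisticToContinuum-13653 · support · rank 9 · open · by planner
sources: OllaVaradhanYau1993, KipnisLandim1999, Spohn1991
CERTIFICATE THAT THE RANK-2 CRUX IS A SHADOW OF THE CONJUNCT: HydrodynamicLimit → ForwardMeanHydro,
with the sub-problem Statement decl `_root_.HydrodynamicLimit` by name (abbrev of
Literature.MathematicalPhysics.KineticTheory.HydrodynamicLimit; route-repair 2026-08-15 re-filing,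
same content). Proof: take σ₀ from the conjunct; convergence in probability of the three fields at t
(TendstoHydroFieldsAt, χ = ξ_ρ, the components of ξ_m, ξ_e; tiltStatistic_eq_fields after rewriting
the inline integral as tiltStatistic by rfl) upgrades to convergence in mean by uniform
integrability: |⟨ξ,F(z)⟩| ≤ C(1 + kinetic energy per particle), the kinetic energy is conserved on
good orbits (configEnergy_eq_holds) and has N-uniformly bounded second moment under the local Gibbs
law (Gaussian velocities given positions). Hence ¬ForwardMeanHydro for some datum refutes the
conjunct for that datum. (The analogous certificate for BackwardMeanHydro needs Euler time-reversal
plus backward continuation of the classical solution past the closed endpoint, Kato1975/Majda1984 —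
recorded in the Two-layer plan, not filed.) [difficulty: M] -/
@[route_item "route-AtomisticToContinuum-MirrorJeffreys"]
def HydroLimitForcesForward : Prop :=
  _root_.HydrodynamicLimit → ForwardMeanHydro

-- earlier Assembly (stmt-AtomisticToContinuum-9240, replaced 2026-08-16T23:35:08Z -> stmt-AtomisticToContinuum-17397): proved by Summit.AtomisticToContinuum.HydrodynamicLimit.Theorems.hydrodynamicLimit_of_relEntropyVanishing — RelEntropyVanishing → _root_.HydrodynamicLimit
/-- item stmt-AtomisticToContinuum-17397 · assembly · rank 1 · open · by planner
sources: Yau1991, OllaVaradhanYau1993, KipnisLandim1999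
[support] GUARDED ENTROPY DOCK (packing-guarded twin of the closed glue item
stmt-AtomisticToContinuum-0769 EntropyToFields): RelEntropyVanishingInBand → the re-typed conjunct
`_root_.HydrodynamicLimit`. Proof (8 lines, checked rc 0 in the planner's Sketch.lean, attached as
evidence): take η₀ and σ₀ from the hypothesis; for σ < σ₀, a guarded classical solution, Φ,
convergence at t = 0 and t < T, obtain ⟨a_t, probability, concentration, klDiv → 0⟩ and apply the
tree lemma Summit.AtomisticToContinuum.HydrodynamicLimit.Theorems.tendstoHydroFieldsAt_of_klDiv
(Theorems/TwoClocksEntropyToHydro.lean: entropy inequality for events μ(A)·L ≤ KL(μ‖ν) + (e^L −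
1)ν(A), exponential concentration of the reference, transfer along the measurable flow). Becomes the
last hypothesis of `closes` (replacing EntropyToFields + HydrodynamicLimit.of_unguarded) once crux
#4 is restated to conclude RelEntropyVanishingInBand. [deps: RelEntropyVanishingInBand] [difficulty:
S] -/
@[route_item "route-AtomisticToContinuum-MirrorJeffreys"]
def Assembly : Prop :=
  RelEntropyVanishingInBand → _root_.HydrodynamicLimit

-- records of items no longer active in this route (dropped / restated):
-- earlier JeffreysIdentity (stmt-AtomisticToContinuum-12334, replaced 2026-08-15T19:30:42Z -> stmt-AtomisticToContinuum-13651): retired by None — ∀ (σ : ℝ) (a₀ θ₀ a θ' : Literature.MathematicalPhysics.KineticTheory.T3 → ℝ) (u₀ u' : Literature.MathematicalPhysics.KineticTheory.T3 → Literature.MathematicalPhysics.KineticTheory.V3), 0 < σ → Continuous a₀ → Continuous θ₀ → Continuous u₀ → Continuous a →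
-- earlier TargetGibbsStatics (stmt-AtomisticToContinuum-12335, replaced 2026-08-16T23:35:08Z -> stmt-AtomisticToContinuum-17769): retired by None — ∀ (a₀ θ₀ : Literature.MathematicalPhysics.KineticTheory.T3 → ℝ) (u₀ : Literature.MathematicalPhysics.KineticTheory.T3 → Literature.MathematicalPhysics.KineticTheory.V3), Continuous a₀ → Continuous θ₀ → Continuous u₀ → (∀ x, 0 < a₀ x) → (∀ x, 0 < θ₀ x) → 
-- earlier TwoSidedClosure (stmt-AtomisticToContinuum-12336, replaced 2026-08-15T19:30:42Z -> stmt-AtomisticToContinuum-13652): retired by None — ForwardMeanHydro → BackwardMeanHydro → JeffreysIdentity → TargetGibbsStatics → RelEntropyVanishing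
-- earlier TwoSidedClosure (stmt-AtomisticToContinuum-13652, replaced 2026-08-16T23:35:08Z -> stmt-AtomisticToContinuum-17770): retired by None — ForwardMeanHydro ∧ BackwardMeanHydro → JeffreysIdentity → TargetGibbsStatics → RelEntropyVanishing

/-! D-0027 §2.1 — DECIDING THEOREM (planner-authored via `route open/edit --closes-file`; by planner-rbadge-AtomisticToContinuum-MirrorJeff-d1b9ab7b-0 2026-08-17T00:28:15Z):
its hypotheses are this route's items and its conclusion the sub-problem Statement (glue_lint), and it elaborates with this file. -/

/-- DECIDING THEOREM (D-0027 §2.1; rev 9, route-repair 2026-08-17 — CRUX-ONLY): the two packing-guarded MEAN cruxes alone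
imply `_root_.HydrodynamicLimit`; nothing else is assumed. (A) Guarded Grönwall core along every handed-over reference
(antecedent of `EntropyClockDock.relEntropyVanishingInBand_of_gronwallCoreInBand`, `σ₀ ≤ 1/2`): reference tie at 0
(`tie_rhoLim_of_smallDensity`), the four mean limits (Forward at 0, t; Backward at s = 0, t), and the finite-`N`
MIRROR–JEFFREYS BOUND `KL(f_t‖ψ_t).toReal ≤ J_N = (N+1)·(E_f₀Λ₀ − E_f₀[Λ_t∘Φ_t] + E_ψΛ_t − E_ψ[Λ₀∘Φ_(−t)])` from the
tree's KL ledger (`toReal_klDiv_lawAt_localGibbsLaw_sub` at `t`, the echo `klDiv_lawAt_eq` at `−t`,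
`ae_logRatio_eq_oneBody`: the log-partition constants cancel; `stub_klDivLawAtLocalGibbsNeTop`); squeeze. (B) The statics
reduction yields the shared Yau target `RelEntropyVanishingInBand` in the term; `tendstoHydroFieldsAt_of_klDiv` docks. -/
@[closes "route-AtomisticToContinuum-MirrorJeffreys"] theorem closes (h₂ : ForwardMeanHydro) (h₃ : BackwardMeanHydro) : _root_.HydrodynamicLimit := by
  -- (A) guarded Grönwall core from the two mean cruxes via the finite-N Mirror–Jeffreys bound;
  -- (B) tree statics reduction gives the shared Yau target; the tree entropy dock concludes.
  have hR : RelEntropyVanishingInBand :=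
    Theorems.EntropyClockDock.relEntropyVanishingInBand_of_gronwallCoreInBand ?core
  case core =>
    obtain ⟨ηF, hηF, HF⟩ := h₂
    obtain ⟨ηB, hηB, HB⟩ := h₃
    refine ⟨min ηF ηB, lt_min hηF hηB, fun a₀ θ₀ u₀ ha hθ hu ha0 hθ0 => ?_⟩
    obtain ⟨σF, hσF, GF⟩ := HF a₀ θ₀ u₀ ha hθ hu ha0 hθ0
    obtain ⟨σB, hσB, GB⟩ := HB a₀ θ₀ u₀ ha hθ hu ha0 hθ0
    refine ⟨min σF (min σB (1 / 2)), lt_min hσF (lt_min hσB one_half_pos), ?_⟩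
    intro σ hσ hσl T ρ θ u hE hg Φ h0 t ht a hac hap hale hQ hlim
    obtain ⟨hσF', hσ1⟩ := lt_min_iff.mp hσl
    obtain ⟨hσB', hσ2'⟩ := lt_min_iff.mp hσ1
    have hσ2 : σ ≤ 1 / 2 := hσ2'.le
    have ht' : t ∈ Set.Ico 0 T := ⟨ht.1.le, ht.2⟩
    have hut : Continuous (u t) := (hE.smooth_velocity.isSmooth_slice ht').continuous
    have hθt : Continuous (θ t) := (hE.smooth_temperature.isSmooth_slice ht').continuous
    have hθp : ∀ x, 0 < θ t x := hE.temperature_pos t ht'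
    have hP := fun N => Literature.MathematicalPhysics.KineticTheory.isProbabilityMeasure_localGibbsLaw ha hθ hu ha0 hθ0 hσ2 N (Φ N)
    have hΨ := fun N =>
      Literature.MathematicalPhysics.KineticTheory.isProbabilityMeasure_localGibbsLaw hac hθt hut hap hθp hσ2 N (Φ N)
    -- a.e. configuration is good under every local Gibbs law (Liouville-a.c.)
    have hL : ∀ (N : ℕ) (b ϑ : _ → ℝ) (w : _ → Literature.MathematicalPhysics.KineticTheory.V3),
        Literature.MathematicalPhysics.KineticTheory.localGibbsLaw σ b w ϑ N (Φ N) ≪ Literature.Analysis.FluidPDE.liouville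
          (Literature.Analysis.FluidPDE.Torus.geometry (Fin 3)) (N + 1) (Literature.MathematicalPhysics.KineticTheory.hsDiameter σ N) ∧
        ∀ᵐ z ∂(Literature.MathematicalPhysics.KineticTheory.localGibbsLaw σ b w ϑ N (Φ N)), z ∈ (Φ N).good := by
      intro N b ϑ w
      rw [Literature.MathematicalPhysics.KineticTheory.localGibbsLaw, Literature.Analysis.FluidPDE.particleLaw_eq]
      exact ⟨MeasureTheory.withDensity_absolutelyContinuous _ _,
        (MeasureTheory.withDensity_absolutelyContinuous _ _).ae_le (Φ N).ae_mem_good⟩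
    -- Φ_0 = id under local Gibbs laws (integrals of empirical statistics)
    have h0i : ∀ (N : ℕ) (b ϑ : _ → ℝ) (w : _ → _) (g : _ → ℝ),
        ∫ z, (∫ y, g y ∂Literature.Analysis.FluidPDE.empiricalMeasure ((Φ N).flow 0 z))
          ∂(Literature.MathematicalPhysics.KineticTheory.localGibbsLaw σ b w ϑ N (Φ N)) =
        ∫ z, (∫ y, g y ∂Literature.Analysis.FluidPDE.empiricalMeasure z)
          ∂(Literature.MathematicalPhysics.KineticTheory.localGibbsLaw σ b w ϑ N (Φ N)) := fun N b ϑ w g => by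
      refine integral_congr_ae ?_
      filter_upwards [(hL N b ϑ w).2] with z hz
      rw [(Φ N).flow_zero z hz]
    -- THE FOUR MEAN LIMITS (entropy-variable tilts of (a₀,u₀,θ₀) and (a,u_t,θ_t))
    have GF' := GF σ hσ hσF' T ρ θ u hE (fun s hs x => (hg s hs x).trans_le (min_le_left _ _)) Φ hP h0
    have GB' := GB σ hσ hσB' T ρ θ u hE (fun s hs x => (hg s hs x).trans_le (min_le_right _ _)) Φ hP h0 t ht'
      a hac hap hΨ (by
        have h := Theorems.EntropyClockDock.tie_rhoLim_of_smallDensity (u₀ := u t) hac hθt hut hap hθp hσ2 hQ Φ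
        rwa [hlim] at h)
    have c₀ : Continuous fun x => Real.log (a₀ x) - 3 / 2 * Real.log (2 * Real.pi * θ₀ x) - ‖u₀ x‖ ^ 2 / (2 * θ₀ x) := by
      fun_prop (disch := intro x; have := ha0 x; have := hθ0 x; positivity)
    have e₀ : Continuous fun x => -(θ₀ x)⁻¹ := by fun_prop (disch := intro x; exact (hθ0 x).ne')
    have m₀ : Continuous fun x => (θ₀ x)⁻¹ • u₀ x := by fun_prop (disch := intro x; exact (hθ0 x).ne')
    have c₁ : Continuous fun x => Real.log (a x) - 3 / 2 * Real.log (2 * Real.pi * θ t x) - ‖u t x‖ ^ 2 / (2 * θ t x) := by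
      fun_prop (disch := intro x; have := hap x; have := hθp x; positivity)
    have e₁ : Continuous fun x => -(θ t x)⁻¹ := by fun_prop (disch := intro x; exact (hθp x).ne')
    have m₁ : Continuous fun x => (θ t x)⁻¹ • u t x := by fun_prop (disch := intro x; exact (hθp x).ne')
    have h1 := (GF' 0 ⟨le_rfl, ht.1.trans ht.2⟩ _ _ _ c₀ e₀ m₀).congr fun N => h0i N a₀ θ₀ u₀ _
    have h2 := GF' t ht' _ _ _ c₁ e₁ m₁
    have h3 := GB' 0 ⟨le_rfl, ht.1.le⟩ _ _ _ c₁ e₁ m₁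
    rw [neg_zero, sub_zero] at h3
    replace h3 := h3.congr fun N => h0i N a (θ t) (u t) _
    have h4 := GB' t ⟨ht.1.le, le_rfl⟩ _ _ _ c₀ e₀ m₀
    rw [sub_self] at h4
    have hb := ((h1.sub h2).add h3).sub h4
    rw [sub_add_cancel, sub_self] at hb
    -- one-body sums = (N+1) × tilt statistics (pure algebra)
    have hconv : ∀ (N : ℕ) (b ϑ : _ → ℝ) (w : _ → Literature.MathematicalPhysics.KineticTheory.V3)
        (z : Literature.Analysis.FluidPDE.Config (N + 1) (Fin 3) Literature.MathematicalPhysics.KineticTheory.T3),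
        ((N : ℝ) + 1) * ∫ y, (Real.log (b y.1) - 3 / 2 * Real.log (2 * Real.pi * ϑ y.1) -
            ‖w y.1‖ ^ 2 / (2 * ϑ y.1) + ⟪(ϑ y.1)⁻¹ • w y.1, y.2⟫_ℝ + -(ϑ y.1)⁻¹ * (‖y.2‖ ^ 2 / 2))
            ∂Literature.Analysis.FluidPDE.empiricalMeasure z =
          ∑ i, (Real.log (b (z i).1) - 3 / 2 * Real.log (2 * Real.pi * ϑ (z i).1) -
            ‖(z i).2 - w (z i).1‖ ^ 2 / (2 * ϑ (z i).1)) := by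
      intro N b ϑ w z
      rw [Literature.Analysis.FluidPDE.integral_empiricalMeasure]
      push_cast
      rw [← mul_assoc, mul_inv_cancel₀ (by positivity : ((N : ℝ) + 1) ≠ 0), one_mul]
      refine Finset.sum_congr rfl fun i _ => ?_
      rw [norm_sub_sq_real, real_inner_smul_left, real_inner_comm (w (z i).1) ((z i).2)]
      ring
    -- KL/(N+1) → 0: squeeze in ℝ under the Jeffreys sum J_N = (N+1)·(bracket → 0), then back to ℝ≥0∞
    refine (ENNReal.tendsto_toReal_iff (fun N => ENNReal.div_ne_top
      (Theorems.QuenchedCellClock.stub_klDivLawAtLocalGibbsNeTop hσ hσ2 ha hθ hu ha0 hθ0 hac hθt hut hap hθp N (Φ N) t)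
      (by simp)) ENNReal.zero_ne_top).mp ?_
    simp only [ENNReal.toReal_zero, ENNReal.toReal_div, ENNReal.toReal_add (ENNReal.natCast_ne_top _)
      ENNReal.one_ne_top, ENNReal.toReal_natCast, ENNReal.toReal_one]
    refine squeeze_zero (fun N => div_nonneg ENNReal.toReal_nonneg (by positivity)) (fun N => ?_) hb
    -- THE FINITE-N MIRROR–JEFFREYS BOUND at σ ≤ 1/2: KL(f_t‖ψ).toReal ≤ J_N(t)
    rw [div_le_iff₀' (by positivity : (0 : ℝ) < N + 1), mul_sub, mul_add, mul_sub]
    have iP := hP N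
    have iΨ := hΨ N
    obtain ⟨C₀, -, hC₀⟩ := Theorems.QuenchedCellClock.abs_oneBody_le ha hθ hu ha0 hθ0
    obtain ⟨C₁, -, hC₁⟩ := Theorems.QuenchedCellClock.abs_oneBody_le hac hθt hut hap hθp
    have hE₀ := Theorems.QuenchedCellClock.integrable_sum_norm_sq_localGibbsLaw ha hθ hu (fun x => (ha0 x).le) hθ0 N (Φ N)
    have hE₁ := Theorems.QuenchedCellClock.integrable_sum_norm_sq_localGibbsLaw hac hθt hut (fun x => (hap x).le) hθp N (Φ N)
    have hm₀ := Theorems.QuenchedCellClock.measurable_sum_oneBody ha hθ hu (N + 1)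
    have hm₁ := Theorems.QuenchedCellClock.measurable_sum_oneBody hac hθt hut (N + 1)
    -- kinetic energy is conserved on good orbits
    have hen : ∀ s : ℝ, ∀ z ∈ (Φ N).good, ∑ i, ‖((Φ N).flow s z i).2‖ ^ 2 = ∑ i, ‖(z i).2‖ ^ 2 := fun s z hz => by
      have h := (Φ N).configEnergy_flow hz s
      simp only [Literature.Analysis.FluidPDE.configEnergy] at h
      linarith
    -- integrability of the four one-body sums (domination by the kinetic energy)
    have hS₀ := ((integrable_const (C₀ * ((N + 1 : ℕ) : ℝ))).add (hE₀.const_mul C₀)).mono' hm₀.aestronglyMeasurable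
      (Eventually.of_forall fun z => by
        rw [Real.norm_eq_abs]; exact Theorems.QuenchedCellClock.abs_sum_oneBody_le hC₀ z)
    have hSt := ((integrable_const (C₁ * ((N + 1 : ℕ) : ℝ))).add (hE₀.const_mul C₁)).mono'
      (hm₁.fun_comp ((Φ N).measurable_flow t)).aestronglyMeasurable (by
        filter_upwards [(hL N a₀ θ₀ u₀).2] with z hz
        simp only [Real.norm_eq_abs, Pi.add_apply]
        exact hen t z hz ▸ Theorems.QuenchedCellClock.abs_sum_oneBody_le hC₁ ((Φ N).flow t z))
    have hS₁ := ((integrable_const (C₁ * ((N + 1 : ℕ) : ℝ))).add (hE₁.const_mul C₁)).mono' hm₁.aestronglyMeasurable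
      (Eventually.of_forall fun z => by
        rw [Real.norm_eq_abs]; exact Theorems.QuenchedCellClock.abs_sum_oneBody_le hC₁ z)
    have hSr := ((integrable_const (C₀ * ((N + 1 : ℕ) : ℝ))).add (hE₁.const_mul C₀)).mono'
      (hm₀.fun_comp ((Φ N).measurable_flow (-t))).aestronglyMeasurable (by
        filter_upwards [(hL N a (θ t) (u t)).2] with z hz
        simp only [Real.norm_eq_abs, Pi.add_apply]
        exact hen (-t) z hz ▸ Theorems.QuenchedCellClock.abs_sum_oneBody_le hC₀ ((Φ N).flow (-t) z))
    -- log-ratios are one-body sums plus log-partition constants (a.s.)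
    have A1 := Theorems.EntropyClockDock.ae_logRatio_eq_oneBody hσ2 a₀ θ₀ u₀ ha hθ hu ha0 hθ0 hac hθt hut hap hθp N (Φ N) t
    have A2 := Theorems.EntropyClockDock.ae_logRatio_eq_oneBody hσ2 a (θ t) (u t) hac hθt hut hap hθp ha hθ hu ha0 hθ0
      N (Φ N) (-t)
    -- forward ledger at t; reverse = ledger of ψ at −t through the ECHO KL(ψ‖(Φ_t)_#f₀) = KL((Φ_(−t))_#ψ‖f₀)
    have F1 := Theorems.toReal_klDiv_lawAt_localGibbsLaw_sub hσ2 ha hθ hu ha0 hθ0 ha hθ hu ha0 hθ0 hac hθt hut hap hθp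
      N (Φ N) t (by simp only [sub_self]; exact integrable_const _)
      ((integrable_congr A1).mpr ((hS₀.sub' hSt).fun_add (integrable_const _)))
    have R1 := Theorems.toReal_klDiv_lawAt_localGibbsLaw_sub hσ2 hac hθt hut hap hθp hac hθt hut hap hθp ha hθ hu ha0 hθ0
      N (Φ N) (-t) (by simp only [sub_self]; exact integrable_const _)
      ((integrable_congr A2).mpr ((hS₁.sub' hSr).fun_add (integrable_const _)))
    rw [InformationTheory.klDiv_self, ENNReal.toReal_zero, sub_zero] at F1 R1
    rw [Theorems.klDiv_lawAt_eq (Φ N) _ _ (hL N a (θ t) (u t)).1 (hL N a₀ θ₀ u₀).1 (-t), neg_neg,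
      ← Literature.Analysis.FluidPDE.HardSphereFlow.lawAt_eq, integral_congr_ae A2,
      integral_add (hS₁.sub' hSr) (integrable_const _), integral_sub hS₁ hSr] at R1
    rw [integral_congr_ae A1, integral_add (hS₀.sub' hSt) (integrable_const _), integral_sub hS₀ hSt] at F1
    simp only [integral_const, probReal_univ, one_smul] at F1 R1
    -- the constants cancel in the Jeffreys sum; one-body sums are (N+1) × the tilt statistics
    simp_rw [← hconv N a₀ θ₀ u₀, ← hconv N a (θ t) (u t), integral_const_mul] at F1 R1
    linarith [ENNReal.toReal_nonneg.trans_eq R1]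
  -- (B)
  obtain ⟨η₀, hη₀, H⟩ := hR
  refine ⟨η₀, hη₀, fun a₀ θ₀ u₀ ha hθ hu ha0 hθ0 => ?_⟩
  obtain ⟨σ₀, hσ₀, G⟩ := H a₀ θ₀ u₀ ha hθ hu ha0 hθ0
  refine ⟨σ₀, hσ₀, fun σ hσ hσ' T ρ θ u hE hg Φ h0 t ht => ?_⟩
  obtain ⟨hp, hm⟩ := G σ hσ hσ' T ρ θ u hE hg Φ
  obtain ⟨a, hq, hc, hk⟩ := hm h0 t ht
  exact Theorems.tendstoHydroFieldsAt_of_klDiv (a := a) Φ hc hk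

end Summit.AtomisticToContinuum.HydrodynamicLimit.Theses.MirrorJeffreys
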